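import Summits.HubbardSuperconductivity.HubbardSuperconductivity.Theorems.FunctionFieldCertificateMesoscopicPairOrderSplit

/-!
# BC2 redirect of `MesoscopicPairOrder` (stmt-HubbardSuperconductivity-7331) — (b) the assembly is PROVED

Pieces (k = 2): `GoldstonePairProfile` (A), `LeakBeatingBlockPairSeed` (B) — defs below, verbatim the
children statements of the route split. Assembly: the LANDED tree theorem
`Theorems.FunctionFieldCertificate.mesoscopicPairOrderOfSubs` (p137259; pointwise one-scale closure —
NOT a trivial seam: `R₀²T_{R₀} = Σ_m |F_{R₀}(m)|² S_ψ(m)`, kernel cap `R₀⁴` on the zero mode and the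
punctured window, profile cap off the window against Parseval, then the Fejér floor p90865).
Also recorded: (B) is NECESSARY for the parent and for the summit; (A) implies the route's other crux
`WindowInfraredBound` (stmt-1089); the route's `closes` fed by the pieces.
-/

noncomputable section

namespace Summit.HubbardSuperconductivity.HubbardSuperconductivity.Theses.FunctionFieldCertificate

/-- (A) GOLDSTONE PAIR PROFILE — the pole half, pointwise and zone-wide (child 1 of the split; statement
verbatim = hypothesis 1 of the landed glue `mesoscopicPairOrderOfSubs`). -/
def GoldstonePairProfile : Prop :=
  ∀ U : ℝ, 0 < U → ∀ δ ∈ Set.Ioo (0:ℝ) (1 / 2), ∃ S A : ℝ, 0 ≤ S ∧ 0 ≤ A ∧ ∃ L₀ : ℕ, ∀ (L : ℕ) [NeZero L], L₀ ≤ L → Even L → ∀ ψ : Literature.MathematicalPhysics.QuantumLattice.Fock (Literature.MathematicalPhysics.QuantumLattice.Orb (Literature.MathematicalPhysics.QuantumLattice.FermionTorus 2 L)), star ψ ⬝ᵥ ψ = 1 → Literature.MathematicalPhysics.QuantumLattice.IsGroundStateInSector (Literature.MathematicalPhysics.QuantumLattice.hubbardTorus 2 L 1 U) (2 * ⌊(1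 - δ) * (L : ℝ) ^ 2 / 2⌋₊) 0 ψ → ∀ m : Literature.Probability.LatticeModels.TorusSite 2 L, m ≠ 0 → Literature.MathematicalPhysics.QuantumLattice.pairStructureFactor Literature.MathematicalPhysics.QuantumLattice.dWaveFormFactor L ψ m ≤ S + A / Real.sqrt (Literature.MathematicalPhysics.QuantumLattice.momentumNormSq L m)

/-- (B) LEAK-BEATING BLOCK PAIR SEED — the parent at ONE scale (child 2 of the split; statement verbatim =
hypothesis 2 of the landed glue `mesoscopicPairOrderOfSubs`). -/
def LeakBeatingBlockPairSeed : Prop :=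
  ∃ U : ℝ, 0 < U ∧ ∃ δ ∈ Set.Ioo (0:ℝ) (1 / 2), ∀ S A : ℝ, 0 ≤ S → 0 ≤ A → ∃ (R₀ : ℕ) (ε m₀ : ℝ), 0 < R₀ ∧ 0 < ε ∧ 32 * ε * (S * ε + A) + (S + A / ε) / (R₀ : ℝ) ^ 2 < m₀ ∧ ∃ L₀ : ℕ, ∀ (L : ℕ) [NeZero L], L₀ ≤ L → Even L → ∀ ψ : Literature.MathematicalPhysics.QuantumLattice.Fock (Literature.MathematicalPhysics.QuantumLattice.Orb (Literature.MathematicalPhysics.QuantumLattice.FermionTorus 2 L)), star ψ ⬝ᵥ ψ = 1 → Literature.MathematicalPhysics.QuantumLattice.IsGroundStateInSector (Literature.MathematicalPhysics.QuantumLattice.hubbardTorus 2 L 1 U) (2 * ⌊(1 - δ) * (L : ℝ) ^ 2 / 2⌋₊) 0 ψ → m₀ * (R₀ : ℝ) ^ 2 ≤ (∑ x : Fin 2 → ZMod L, ∑ y : Fin 2 → ZMod L, (∏ i : Fin 2, max 0 (1 - |(((y i - x i).valMinAbs : ℤ) : ℝ)| / (R₀ : ℝ))) * (star (Matrix.mulVec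 (Literature.MathematicalPhysics.QuantumLattice.localPair Literature.MathematicalPhysics.QuantumLattice.dWaveFormFactor L x) ψ) ⬝ᵥ Matrix.mulVec (Literature.MathematicalPhysics.QuantumLattice.localPair Literature.MathematicalPhysics.QuantumLattice.dWaveFormFactor L y) ψ).re) / (L : ℝ) ^ 2

open Summit.HubbardSuperconductivity.HubbardSuperconductivity.Theorems.FunctionFieldCertificate in
/-- **(b) assembly**: `(A) → (B) → MesoscopicPairOrder` is the landed glue, applied to the defs by `δ`. -/
theorem MesoscopicPairOrder_of_pieces (hA : GoldstonePairProfile) (hB : LeakBeatingBlockPairSeed) :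
    MesoscopicPairOrder :=
  mesoscopicPairOrderOfSubs hA hB

open Summit.HubbardSuperconductivity.HubbardSuperconductivity.Theorems.FunctionFieldCertificate in
/-- (B) is necessary for the parent … -/
theorem LeakBeatingBlockPairSeed_of_meso (h : MesoscopicPairOrder) : LeakBeatingBlockPairSeed :=
  leakBeatingBlockPairSeed_of_mesoscopicPairOrder h

open Summit.HubbardSuperconductivity.HubbardSuperconductivity.Theorems.FunctionFieldCertificate in
/-- … hence for the summit (two landed lemmas deep: not a one-step `exact?`). -/
theorem LeakBeatingBlockPairSeed_of_summit (h : _root_.HubbardSuperconductivity) : LeakBeatingBlockPairSeed :=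
  leakBeatingBlockPairSeed_of_mesoscopicPairOrder (mesoscopicPairOrder_of_hubbardSuperconductivity h)

open Summit.HubbardSuperconductivity.HubbardSuperconductivity.Theorems.FunctionFieldCertificate in
/-- (A) implies the route's pole half (stmt-1089). -/
theorem WindowInfraredBound_of_GoldstonePairProfile (h : GoldstonePairProfile) : WindowInfraredBound :=
  windowInfraredBound_of_goldstonePairProfile h

/-- After the split the route's leaves (A), (B) already feed `closes` (its second hypothesis
`WindowInfraredBound` being implied by (A)). -/
theorem summit_of_pieces (hA : GoldstonePairProfile) (hB : LeakBeatingBlockPairSeed) :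
    _root_.HubbardSuperconductivity :=
  closes (MesoscopicPairOrder_of_pieces hA hB) (WindowInfraredBound_of_GoldstonePairProfile hA)

end Summit.HubbardSuperconductivity.HubbardSuperconductivity.Theses.FunctionFieldCertificate
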